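import Summits.Ventures.HodgeRepro2.T5BergmanPointwise

/-!
# Completeness of the weighted Bergman space

The weighted Bergman space `A_k = {f holomorphic on 𝔻 : ∫_𝔻 |f|² (1 - |z|²)^{k-2} dA < ∞}` with the
pairing `⟨·,·⟩_k` of `T5BergmanCoefficient` is COMPLETE (`k ≥ 2`): a sequence `f_j ∈ A_k` that is Cauchy
for the norm `⟨f, f⟩_k^{1/2}` converges

* locally uniformly on `𝔻` to a holomorphic `g` (`T5BergmanPointwise.norm_sq_le_pairing_of_norm_le`:
  `L²`-Cauchy ⇒ uniformly Cauchy on every `|z| ≤ r < 1`; Mathlib's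
  `TendstoLocallyUniformlyOn.differentiableOn`),
* with `g ∈ A_k` and `⟨f_j - g, f_j - g⟩_k → 0` (Fatou's lemma `lintegral_liminf_le'`).

This is the «completeness of the model (Hilbert-space closure)» item of the explicit model's record, in
the elementary form «every Cauchy sequence of the space converges in the space» — no quotient by null
functions is needed because holomorphic functions with `⟨f, f⟩_k = 0` vanish identically
(`T5BergmanPointwise.eq_zero_of_pairing_self_eq_zero`).

Blind lane: Mathlib + the HodgeRepro2 prefix only (own files + p2's `DiscMeanValue` through
`T5BergmanPointwise`); no sorry; axioms ⊆ {propext, Classical.choice, Quot.sound}.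
-/

namespace Summit.Ventures.HodgeRepro2.T5BergmanComplete

open MeasureTheory Metric Filter Topology T5BergmanCoefficient T5BergmanPairing T5BergmanPointwise
open scoped Real ENNReal

/-! ### Differences stay in the space -/

/-- The weight `z ↦ (1 - |z|²)^{k-2}` is continuous. -/
lemma continuous_weight (k : ℕ) : Continuous (weight k) := by
  unfold weight
  fun_prop

/-- The weight is non-negative on `𝔻`. -/
lemma weight_nonneg (k : ℕ) {z : ℂ} (hz : z ∈ ball (0 : ℂ) 1) : 0 ≤ weight k z := by
  have := mem_ball_zero_iff.mp hz
  have h0 : 0 ≤ 1 - ‖z‖ ^ 2 := by nlinarith [norm_nonneg z]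
  unfold weight
  positivity

/-- `|a - b|² ≤ 2|a|² + 2|b|²`. -/
lemma norm_sub_sq_le (a b : ℂ) : ‖a - b‖ ^ 2 ≤ 2 * ‖a‖ ^ 2 + 2 * ‖b‖ ^ 2 := by
  have h := norm_sub_le a b
  have h2 : 0 ≤ ‖a‖ := norm_nonneg a
  have h3 : 0 ≤ ‖b‖ := norm_nonneg b
  nlinarith [sq_nonneg (‖a‖ - ‖b‖), norm_nonneg (a - b)]

/-- If `|f|² w` and `|g|² w` are integrable on `𝔻` and `f, g` are continuous on `𝔻`, so is `|f - g|² w`. -/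
lemma integrableOn_sub_sq (k : ℕ) {f g : ℂ → ℂ} (hf : ContinuousOn f (ball 0 1))
    (hg : ContinuousOn g (ball 0 1))
    (hfi : IntegrableOn (fun w => ‖f w‖ ^ 2 * weight k w) (ball (0 : ℂ) 1))
    (hgi : IntegrableOn (fun w => ‖g w‖ ^ 2 * weight k w) (ball (0 : ℂ) 1)) :
    IntegrableOn (fun w => ‖f w - g w‖ ^ 2 * weight k w) (ball (0 : ℂ) 1) := by
  have hmeas : AEStronglyMeasurable (fun w => ‖f w - g w‖ ^ 2 * weight k w)
      (volume.restrict (ball (0 : ℂ) 1)) :=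
    (((hf.sub hg).norm.pow 2).mul (continuous_weight k).continuousOn).aestronglyMeasurable
      measurableSet_ball
  have hbound : IntegrableOn (fun w => 2 * (‖f w‖ ^ 2 * weight k w) + 2 * (‖g w‖ ^ 2 * weight k w))
      (ball (0 : ℂ) 1) := (hfi.const_mul 2).add (hgi.const_mul 2)
  refine hbound.mono' hmeas ?_
  rw [ae_restrict_iff' measurableSet_ball]
  refine Eventually.of_forall fun w hw => ?_
  have hw0 := weight_nonneg k hw
  rw [Real.norm_eq_abs, abs_of_nonneg (by positivity)]
  have := norm_sub_sq_le (f w) (g w)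
  nlinarith

/-! ### `L²`-Cauchy ⇒ uniformly Cauchy on compact discs -/

/-- `unifConst k r > 0` for `0 ≤ r < 1`. -/
lemma unifConst_pos (k : ℕ) {r : ℝ} (hr0 : 0 ≤ r) (hr : r < 1) : 0 < unifConst k r := by
  unfold unifConst
  have h1 : 0 < 1 - ((1 + r) / 2) ^ 2 := by
    have h2 : 0 < (1 + r) / 2 := by linarith
    have h3 : (1 + r) / 2 < 1 := by linarith
    nlinarith
  have h2 : 0 < (1 - r) / 2 := by linarith
  positivity

/-- A sequence in `A_k`, Cauchy for the pairing norm, is uniformly Cauchy on every `|z| ≤ r < 1`. -/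
theorem uniformCauchySeqOn_closedBall (k : ℕ) (f : ℕ → ℂ → ℂ)
    (hf : ∀ j, DifferentiableOn ℂ (f j) (ball 0 1))
    (hint : ∀ j, IntegrableOn (fun w => ‖f j w‖ ^ 2 * weight k w) (ball (0 : ℂ) 1))
    (hcauchy : ∀ ε > 0, ∃ N, ∀ j ≥ N, ∀ l ≥ N, (pairing k (f j - f l) (f j - f l)).re < ε)
    {r : ℝ} (hr : r < 1) :
    UniformCauchySeqOn f atTop (closedBall (0 : ℂ) r) := by
  rw [Metric.uniformCauchySeqOn_iff]
  intro ε hε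
  rcases lt_or_ge r 0 with hr0 | hr0
  · exact ⟨0, fun m _ n _ z hz => absurd hz (by rw [closedBall_eq_empty.mpr hr0]; exact Set.notMem_empty z)⟩
  have hC : 0 < unifConst k r := unifConst_pos k hr0 hr
  obtain ⟨N, hN⟩ := hcauchy (ε ^ 2 / unifConst k r) (by positivity)
  refine ⟨N, fun m hm n hn z hz => ?_⟩
  have hzr : ‖z‖ ≤ r := mem_closedBall_zero_iff.mp hz
  have hd : DifferentiableOn ℂ (f m - f n) (ball 0 1) := (hf m).sub (hf n)
  have hi : IntegrableOn (fun w => ‖(f m - f n) w‖ ^ 2 * weight k w) (ball (0 : ℂ) 1) :=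
    integrableOn_sub_sq k (hf m).continuousOn (hf n).continuousOn (hint m) (hint n)
  have h1 := norm_sq_le_pairing_of_norm_le k (f m - f n) hd hi hr hzr
  have h2 := hN m hm n hn
  rw [dist_eq_norm]
  have h3 : ‖(f m - f n) z‖ ^ 2 < ε ^ 2 := by
    calc ‖(f m - f n) z‖ ^ 2 ≤ unifConst k r * (pairing k (f m - f n) (f m - f n)).re := h1
      _ < unifConst k r * (ε ^ 2 / unifConst k r) := mul_lt_mul_of_pos_left h2 hC
      _ = ε ^ 2 := by rw [mul_comm]; exact div_mul_cancel₀ (ε ^ 2) hC.ne'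
  have h4 : ‖(f m - f n) z‖ < ε := by
    by_contra h
    have h' : ε ≤ ‖(f m - f n) z‖ := le_of_not_gt h
    have := pow_le_pow_left₀ hε.le h' 2
    linarith
  simpa using h4

/-! ### The pointwise limit and locally uniform convergence -/

/-- **The pointwise limit exists on `𝔻`**. -/
theorem exists_pointwise_limit (k : ℕ) (f : ℕ → ℂ → ℂ)
    (hf : ∀ j, DifferentiableOn ℂ (f j) (ball 0 1))
    (hint : ∀ j, IntegrableOn (fun w => ‖f j w‖ ^ 2 * weight k w) (ball (0 : ℂ) 1))
    (hcauchy : ∀ ε > 0, ∃ N, ∀ j ≥ N, ∀ l ≥ N, (pairing k (f j - f l) (f j - f l)).re < ε) :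
    ∃ g : ℂ → ℂ, ∀ z ∈ ball (0 : ℂ) 1, Tendsto (fun j => f j z) atTop (𝓝 (g z)) := by
  have key : ∀ z : ℂ, ∃ L : ℂ, z ∈ ball (0 : ℂ) 1 → Tendsto (fun j => f j z) atTop (𝓝 L) := by
    intro z
    by_cases hz : z ∈ ball (0 : ℂ) 1
    · have hr : ‖z‖ < 1 := mem_ball_zero_iff.mp hz
      have hu := uniformCauchySeqOn_closedBall k f hf hint hcauchy hr
      have hc : CauchySeq (fun j => f j z) := hu.cauchySeq (mem_closedBall_zero_iff.mpr le_rfl)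
      obtain ⟨L, hL⟩ := cauchySeq_tendsto_of_complete hc
      exact ⟨L, fun _ => hL⟩
    · exact ⟨0, fun h => absurd h hz⟩
  choose g hg using key
  exact ⟨g, hg⟩

/-- Uniform convergence to the pointwise limit on every `|z| ≤ r < 1`. -/
theorem tendstoUniformlyOn_closedBall (k : ℕ) (f : ℕ → ℂ → ℂ)
    (hf : ∀ j, DifferentiableOn ℂ (f j) (ball 0 1))
    (hint : ∀ j, IntegrableOn (fun w => ‖f j w‖ ^ 2 * weight k w) (ball (0 : ℂ) 1))
    (hcauchy : ∀ ε > 0, ∃ N, ∀ j ≥ N, ∀ l ≥ N, (pairing k (f j - f l) (f j - f l)).re < ε)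
    {g : ℂ → ℂ} (hg : ∀ z ∈ ball (0 : ℂ) 1, Tendsto (fun j => f j z) atTop (𝓝 (g z)))
    {r : ℝ} (hr : r < 1) :
    TendstoUniformlyOn f g atTop (closedBall (0 : ℂ) r) :=
  (uniformCauchySeqOn_closedBall k f hf hint hcauchy hr).tendstoUniformlyOn_of_tendsto
    fun z hz => hg z (closedBall_subset_ball hr hz)

/-- A compact subset of `𝔻` lies in some `|z| ≤ r < 1`. -/
lemma exists_closedBall_of_isCompact {K : Set ℂ} (hK : IsCompact K) (hKU : K ⊆ ball (0 : ℂ) 1) :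
    ∃ r : ℝ, r < 1 ∧ K ⊆ closedBall (0 : ℂ) r := by
  rcases K.eq_empty_or_nonempty with h | hne
  · exact ⟨0, zero_lt_one, by rw [h]; exact Set.empty_subset _⟩
  obtain ⟨z₀, hz₀, hmax⟩ := hK.exists_isMaxOn hne continuous_norm.continuousOn
  refine ⟨‖z₀‖, mem_ball_zero_iff.mp (hKU hz₀), fun z hz => ?_⟩
  rw [mem_closedBall_zero_iff]
  exact (isMaxOn_iff.mp hmax) z hz

/-- **Locally uniform convergence on `𝔻`** to the pointwise limit. -/
theorem tendstoLocallyUniformlyOn (k : ℕ) (f : ℕ → ℂ → ℂ)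
    (hf : ∀ j, DifferentiableOn ℂ (f j) (ball 0 1))
    (hint : ∀ j, IntegrableOn (fun w => ‖f j w‖ ^ 2 * weight k w) (ball (0 : ℂ) 1))
    (hcauchy : ∀ ε > 0, ∃ N, ∀ j ≥ N, ∀ l ≥ N, (pairing k (f j - f l) (f j - f l)).re < ε)
    {g : ℂ → ℂ} (hg : ∀ z ∈ ball (0 : ℂ) 1, Tendsto (fun j => f j z) atTop (𝓝 (g z))) :
    TendstoLocallyUniformlyOn f g atTop (ball (0 : ℂ) 1) := by
  rw [tendstoLocallyUniformlyOn_iff_forall_isCompact isOpen_ball]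
  intro K hKU hK
  obtain ⟨r, hr, hKr⟩ := exists_closedBall_of_isCompact hK hKU
  exact (tendstoUniformlyOn_closedBall k f hf hint hcauchy hg hr).mono hKr

/-- **The limit is holomorphic on `𝔻`** (a locally uniform limit of holomorphic functions). -/
theorem differentiableOn_limit (k : ℕ) (f : ℕ → ℂ → ℂ)
    (hf : ∀ j, DifferentiableOn ℂ (f j) (ball 0 1))
    (hint : ∀ j, IntegrableOn (fun w => ‖f j w‖ ^ 2 * weight k w) (ball (0 : ℂ) 1))
    (hcauchy : ∀ ε > 0, ∃ N, ∀ j ≥ N, ∀ l ≥ N, (pairing k (f j - f l) (f j - f l)).re < ε)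
    {g : ℂ → ℂ} (hg : ∀ z ∈ ball (0 : ℂ) 1, Tendsto (fun j => f j z) atTop (𝓝 (g z))) :
    DifferentiableOn ℂ g (ball 0 1) :=
  (tendstoLocallyUniformlyOn k f hf hint hcauchy hg).differentiableOn (Eventually.of_forall hf)
    isOpen_ball

/-! ### Fatou: the limit is in the space, and the convergence holds in norm -/

/-- `z ↦ |a(z) - b(z)|² w(z)` is continuous on `𝔻` for `a, b` continuous on `𝔻`. -/
lemma continuousOn_sub_sq_weight (k : ℕ) {a b : ℂ → ℂ} (ha : ContinuousOn a (ball 0 1))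
    (hb : ContinuousOn b (ball 0 1)) :
    ContinuousOn (fun z => ‖a z - b z‖ ^ 2 * weight k z) (ball (0 : ℂ) 1) :=
  (((ha.sub hb).norm.pow 2).mul (continuous_weight k).continuousOn)

/-- `|a - b|² w ≥ 0` a.e. on `𝔻`. -/
lemma ae_nonneg_sub_sq_weight (k : ℕ) (a b : ℂ → ℂ) :
    0 ≤ᵐ[volume.restrict (ball (0 : ℂ) 1)] fun z => ‖a z - b z‖ ^ 2 * weight k z := by
  rw [Filter.EventuallyLE, ae_restrict_iff' measurableSet_ball]
  exact Eventually.of_forall fun z hz => by have := weight_nonneg k hz; positivity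

/-- **Fatou along `l → ∞`**: if `⟨f_j - f_l, f_j - f_l⟩_k ≤ ε` for all `j, l ≥ N`, then
`∫⁻_𝔻 |f_j - g|² w ≤ ε` for `j ≥ N`, `g` the pointwise limit. -/
theorem lintegral_sub_limit_le (k : ℕ) (f : ℕ → ℂ → ℂ)
    (hf : ∀ j, DifferentiableOn ℂ (f j) (ball 0 1))
    (hint : ∀ j, IntegrableOn (fun w => ‖f j w‖ ^ 2 * weight k w) (ball (0 : ℂ) 1))
    {g : ℂ → ℂ} (hg : ∀ z ∈ ball (0 : ℂ) 1, Tendsto (fun j => f j z) atTop (𝓝 (g z)))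
    {ε : ℝ} {N : ℕ} (hN : ∀ j ≥ N, ∀ l ≥ N, (pairing k (f j - f l) (f j - f l)).re ≤ ε)
    {j : ℕ} (hj : N ≤ j) :
    ∫⁻ z in ball (0 : ℂ) 1, ENNReal.ofReal (‖f j z - g z‖ ^ 2 * weight k z) ≤ ENNReal.ofReal ε := by
  set μ : Measure ℂ := volume.restrict (ball (0 : ℂ) 1) with hμ
  set F : ℕ → ℂ → ℝ≥0∞ := fun l z => ENNReal.ofReal (‖f j z - f l z‖ ^ 2 * weight k z) with hF
  have hmeas : ∀ l, AEMeasurable (F l) μ := fun l =>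
    ENNReal.measurable_ofReal.comp_aemeasurable
      ((continuousOn_sub_sq_weight k (hf j).continuousOn (hf l).continuousOn).aemeasurable
        measurableSet_ball)
  have hlim : ∀ z ∈ ball (0 : ℂ) 1, Tendsto (fun l => F l z) atTop
      (𝓝 (ENNReal.ofReal (‖f j z - g z‖ ^ 2 * weight k z))) := fun z hz =>
    ENNReal.continuous_ofReal.continuousAt.tendsto.comp
      (((tendsto_const_nhds.sub (hg z hz)).norm.pow 2).mul_const _)
  have h1 : ∫⁻ z, ENNReal.ofReal (‖f j z - g z‖ ^ 2 * weight k z) ∂μ =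
      ∫⁻ z, liminf (fun l => F l z) atTop ∂μ := by
    apply lintegral_congr_ae
    rw [Filter.EventuallyEq, hμ, ae_restrict_iff' measurableSet_ball]
    exact Eventually.of_forall fun z hz => ((hlim z hz).liminf_eq).symm
  have h2 : ∀ l ≥ N, ∫⁻ z, F l z ∂μ ≤ ENNReal.ofReal ε := by
    intro l hl
    have hi : IntegrableOn (fun w => ‖f j w - f l w‖ ^ 2 * weight k w) (ball (0 : ℂ) 1) :=
      integrableOn_sub_sq k (hf j).continuousOn (hf l).continuousOn (hint j) (hint l)
    rw [hF, ← ofReal_integral_eq_lintegral_ofReal hi (ae_nonneg_sub_sq_weight k (f j) (f l))]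
    apply ENNReal.ofReal_le_ofReal
    have := hN j hj l hl
    rw [pairing_self_eq, Complex.ofReal_re] at this
    exact this
  calc ∫⁻ z, ENNReal.ofReal (‖f j z - g z‖ ^ 2 * weight k z) ∂μ
      = ∫⁻ z, liminf (fun l => F l z) atTop ∂μ := h1
    _ ≤ liminf (fun l => ∫⁻ z, F l z ∂μ) atTop := lintegral_liminf_le' hmeas
    _ ≤ ENNReal.ofReal ε := by
        apply liminf_le_of_le (by isBoundedDefault)
        intro b hb
        obtain ⟨n, hn1, hn2⟩ := (hb.and (eventually_atTop.mpr ⟨N, h2⟩)).exists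
        exact hn1.trans hn2

/-- A nonnegative continuous function on `𝔻` with finite `∫⁻` is integrable on `𝔻`. -/
lemma integrableOn_sub_sq_weight_of_lintegral_lt_top (k : ℕ) {a b : ℂ → ℂ}
    (ha : ContinuousOn a (ball 0 1)) (hb : ContinuousOn b (ball 0 1))
    (hfin : ∫⁻ z in ball (0 : ℂ) 1, ENNReal.ofReal (‖a z - b z‖ ^ 2 * weight k z) < ⊤) :
    IntegrableOn (fun z => ‖a z - b z‖ ^ 2 * weight k z) (ball (0 : ℂ) 1) := by
  refine ⟨(continuousOn_sub_sq_weight k ha hb).aestronglyMeasurable measurableSet_ball, ?_⟩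
  rw [hasFiniteIntegral_iff_ofReal (ae_nonneg_sub_sq_weight k a b)]
  exact hfin

/-- **The limit is in the space**: `|g|² w` is integrable on `𝔻`. -/
theorem integrableOn_limit (k : ℕ) (f : ℕ → ℂ → ℂ)
    (hf : ∀ j, DifferentiableOn ℂ (f j) (ball 0 1))
    (hint : ∀ j, IntegrableOn (fun w => ‖f j w‖ ^ 2 * weight k w) (ball (0 : ℂ) 1))
    (hcauchy : ∀ ε > 0, ∃ N, ∀ j ≥ N, ∀ l ≥ N, (pairing k (f j - f l) (f j - f l)).re < ε)
    {g : ℂ → ℂ} (hg : ∀ z ∈ ball (0 : ℂ) 1, Tendsto (fun j => f j z) atTop (𝓝 (g z))) :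
    IntegrableOn (fun w => ‖g w‖ ^ 2 * weight k w) (ball (0 : ℂ) 1) := by
  have hgc : ContinuousOn g (ball 0 1) := (differentiableOn_limit k f hf hint hcauchy hg).continuousOn
  obtain ⟨N, hN⟩ := hcauchy 1 one_pos
  have hfin := lintegral_sub_limit_le k f hf hint hg (fun j hj l hl => (hN j hj l hl).le) (le_refl N)
  have hd : IntegrableOn (fun w => ‖f N w - g w‖ ^ 2 * weight k w) (ball (0 : ℂ) 1) :=
    integrableOn_sub_sq_weight_of_lintegral_lt_top k (hf N).continuousOn hgc
      (lt_of_le_of_lt hfin ENNReal.ofReal_lt_top)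
  have := integrableOn_sub_sq k (hf N).continuousOn ((hf N).continuousOn.sub hgc) (hint N) hd
  refine this.congr_fun (fun w _ => ?_) measurableSet_ball
  simp

/-- **Convergence in the pairing norm**: `⟨f_j - g, f_j - g⟩_k → 0`. -/
theorem tendsto_pairing_sub_limit (k : ℕ) (f : ℕ → ℂ → ℂ)
    (hf : ∀ j, DifferentiableOn ℂ (f j) (ball 0 1))
    (hint : ∀ j, IntegrableOn (fun w => ‖f j w‖ ^ 2 * weight k w) (ball (0 : ℂ) 1))
    (hcauchy : ∀ ε > 0, ∃ N, ∀ j ≥ N, ∀ l ≥ N, (pairing k (f j - f l) (f j - f l)).re < ε)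
    {g : ℂ → ℂ} (hg : ∀ z ∈ ball (0 : ℂ) 1, Tendsto (fun j => f j z) atTop (𝓝 (g z))) :
    Tendsto (fun j => (pairing k (f j - g) (f j - g)).re) atTop (𝓝 0) := by
  have hgc : ContinuousOn g (ball 0 1) := (differentiableOn_limit k f hf hint hcauchy hg).continuousOn
  rw [Metric.tendsto_atTop]
  intro ε hε
  obtain ⟨N, hN⟩ := hcauchy (ε / 2) (by positivity)
  refine ⟨N, fun j hj => ?_⟩
  have hfin := lintegral_sub_limit_le k f hf hint hg (fun j hj l hl => (hN j hj l hl).le) hj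
  have hi : IntegrableOn (fun w => ‖f j w - g w‖ ^ 2 * weight k w) (ball (0 : ℂ) 1) :=
    integrableOn_sub_sq_weight_of_lintegral_lt_top k (hf j).continuousOn hgc
      (lt_of_le_of_lt hfin ENNReal.ofReal_lt_top)
  rw [← ofReal_integral_eq_lintegral_ofReal hi (ae_nonneg_sub_sq_weight k (f j) g),
    ENNReal.ofReal_le_ofReal_iff (by positivity)] at hfin
  rw [dist_zero_right, Real.norm_eq_abs, abs_of_nonneg (pairing_self_nonneg k _).1, pairing_self_eq,
    Complex.ofReal_re]
  calc (∫ w in ball (0 : ℂ) 1, ‖(f j - g) w‖ ^ 2 * (1 - ‖w‖ ^ 2) ^ (k - 2))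
      = ∫ w in ball (0 : ℂ) 1, ‖f j w - g w‖ ^ 2 * weight k w := by rfl
    _ ≤ ε / 2 := hfin
    _ < ε := by linarith

/-! ### The theorem -/

/-- **Completeness of the weighted Bergman space**: a sequence `f_j` of holomorphic functions on `𝔻`
with `|f_j|² (1 - |z|²)^{k-2}` integrable, Cauchy for the pairing norm `⟨·,·⟩_k`, converges locally
uniformly on `𝔻` to a holomorphic `g` with `|g|² (1 - |z|²)^{k-2}` integrable, and
`⟨f_j - g, f_j - g⟩_k → 0`. -/
theorem complete (k : ℕ) (f : ℕ → ℂ → ℂ)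
    (hf : ∀ j, DifferentiableOn ℂ (f j) (ball 0 1))
    (hint : ∀ j, IntegrableOn (fun w => ‖f j w‖ ^ 2 * weight k w) (ball (0 : ℂ) 1))
    (hcauchy : ∀ ε > 0, ∃ N, ∀ j ≥ N, ∀ l ≥ N, (pairing k (f j - f l) (f j - f l)).re < ε) :
    ∃ g : ℂ → ℂ, DifferentiableOn ℂ g (ball 0 1) ∧
      IntegrableOn (fun w => ‖g w‖ ^ 2 * weight k w) (ball (0 : ℂ) 1) ∧
      TendstoLocallyUniformlyOn f g atTop (ball (0 : ℂ) 1) ∧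
      Tendsto (fun j => (pairing k (f j - g) (f j - g)).re) atTop (𝓝 0) := by
  obtain ⟨g, hg⟩ := exists_pointwise_limit k f hf hint hcauchy
  exact ⟨g, differentiableOn_limit k f hf hint hcauchy hg, integrableOn_limit k f hf hint hcauchy hg,
    tendstoLocallyUniformlyOn k f hf hint hcauchy hg, tendsto_pairing_sub_limit k f hf hint hcauchy hg⟩

end Summit.Ventures.HodgeRepro2.T5BergmanComplete
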